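import Literature.AlgebraicGeometry.Motives.AbelianVarietyEndAlgebraOrthogonalBiproduct
import Literature.AlgebraicGeometry.Motives.AbelianVarietyEndAlgebraIsogenyInvariance
import Literature.AlgebraicGeometry.Motives.AbelianVarietyEndAlgebraInstances
import Literature.AlgebraicGeometry.Motives.AbelianVarietyPoincareCompleteReducibility
import Literature.AlgebraicGeometry.Milne1999.CMTypeNonzeroHom
import Mathlib.RingTheory.TensorProduct.Pi
import HarnessLib

/-!
# `End⁰(A × B) = End⁰(A) × End⁰(B)` when `Hom(A, B) = Hom(B, A) = 0`

D. Mumford, *Abelian Varieties* (1970), §19, Corollary 2 of Theorem 3 and p. 174: for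
`X ∼ A₁^{n₁} × ⋯ × A_k^{n_k}` with the `A_i` simple and pairwise non-isogenous,
«`End⁰(X) = ⊕ᵢ M_{nᵢ}(Dᵢ)`»; the case used constantly in the dimension-six tables is the BINARY one:
if there are no non-zero homomorphisms `A → B` and `B → A`, every endomorphism of `A × B` is diagonal,
`End(A × B) ≅ End(A) × End(B)` and hence **`dim_ℚ End⁰(A × B) = dim_ℚ End⁰(A) + dim_ℚ End⁰(B)`**
(Shimura 1998, §5.1, proof of Prop. 3: «`End_ℚ(A)` is identified with the direct sum of the `ℜ_i`»).
The tree has the statement for biproducts `⨁ᵢ Aᵢ` of orthogonal finite families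
(`finrank_endAlgebra_biproduct_eq_sum`, `Motives/AbelianVarietyEndAlgebraOrthogonalBiproduct`); this
file gives it for the binary product `A.prod B` (`Motives/AbelianVarietyProduct`), the shape in which the
Table-X rows meet it (`Y × E`, `Y × Z`, `Y × (E × E)`), together with the two standard sources of the
orthogonality hypothesis.

* §1 `biprod_map_corners_eq`, `exists_ringEquiv_end_biprod_prod` — endomorphisms of `A ⊞ B` are
  diagonal; `End(A ⊞ B) ≃+* End A × End B` (Mathlib's binary-biproduct calculus);
* §2 `nonempty_algEquiv_endAlgebra_biprod_prod`, `finrank_endAlgebra_biprod_of_hom_eq_zero`,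
  **`finrank_endAlgebra_prod_of_hom_eq_zero`** (transport along `biprodIsoProd : A ⊞ B ≅ A.prod B`);
* §3 corollaries: `finrank_endAlgebra_prod_of_isSimple_of_not_isIsogenous` (simple, non-isogenous,
  algebraically closed base field), `finrank_endAlgebra_prod_of_isSimple_of_dim_ne` (simple of different
  dimensions), `finrank_endAlgebra_prod_of_isSimple_of_not_isOfCMType` (over `ℂ`: `A` simple not of CM
  type, `C` of CM type — the tree's `IsOfCMType.of_ne_zero_hom_from_isSimple` / `…_to_isSimple`).

Theorems only; no definition, no named fact; any base field in §1–§2.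

## References
* [MumfordAV1970] D. Mumford, *Abelian Varieties*, TIFR Studies in Math. 5 (1970), §19 Thm. 3,
  Cor. 1–2 and p. 174; §19 Cor. 2 of Thm. 1 (p. 174) for maps between simple abelian varieties.
* [Shimura1998] G. Shimura, *Abelian Varieties with Complex Multiplication and Modular Functions*
  (1998), §5.1, proof of Proposition 3.
* [Milne1999] J. S. Milne, *Lefschetz motives and the Tate conjecture*, Compositio Math. 117 (1999), §2 p. 54
  (CM type passes to simple sub- and quotient varieties).
-/

noncomputable section

open CategoryTheory CategoryTheory.Limits
open scoped TensorProduct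

namespace Literature.AlgebraicGeometry.Motives

namespace AbelianVariety

universe u

variable {k : Type u} [Field k] {A B : AbelianVariety k}

/-! ## §1 Endomorphisms of `A ⊞ B` are diagonal when `Hom(A, B) = Hom(B, A) = 0` -/

/-- **For an orthogonal pair (`Hom(A, B) = 0 = Hom(B, A)`) every endomorphism `G` of `A ⊞ B` is the
biproduct map of its diagonal corners**: `G = (ι₁ G π₁) ⊞ (ι₂ G π₂)`. [cite: MumfordAV1970, §19 (p. 174)] -/
theorem biprod_map_corners_eq (hAB : ∀ f : A ⟶ B, f = 0) (hBA : ∀ g : B ⟶ A, g = 0) (G : A ⊞ B ⟶ A ⊞ B) :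
    biprod.map (biprod.inl ≫ G ≫ biprod.fst) (biprod.inr ≫ G ≫ biprod.snd) = G := by
  refine biprod.hom_ext' _ _ (biprod.hom_ext _ _ ?_ ?_) (biprod.hom_ext _ _ ?_ ?_)
  · rw [Category.assoc, biprod.map_fst, biprod.inl_fst_assoc, Category.assoc]
  · rw [Category.assoc, biprod.map_snd, biprod.inl_snd_assoc, zero_comp, Category.assoc,
      hAB (biprod.inl ≫ G ≫ biprod.snd)]
  · rw [Category.assoc, biprod.map_fst, biprod.inr_fst_assoc, zero_comp, Category.assoc,
      hBA (biprod.inr ≫ G ≫ biprod.fst)]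
  · rw [Category.assoc, biprod.map_snd, biprod.inr_snd_assoc, Category.assoc]

/-- **`End(A ⊞ B) ≅ End(A) × End(B)` for an orthogonal pair**: the ring isomorphism
`G ↦ (ι₁ G π₁, ι₂ G π₂)` (inverse `(f, g) ↦ f ⊞ g`). [cite: MumfordAV1970, §19 Cor. 2 of Thm. 3 and p. 174] -/
theorem exists_ringEquiv_end_biprod_prod (hAB : ∀ f : A ⟶ B, f = 0) (hBA : ∀ g : B ⟶ A, g = 0) :
    ∃ e : End (A ⊞ B) ≃+* End A × End B,
      ∀ G, e G = (End.of (biprod.inl ≫ End.asHom G ≫ biprod.fst), End.of (biprod.inr ≫ End.asHom G ≫ biprod.snd)) := by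
  let e : End (A ⊞ B) ≃+* End A × End B :=
    { toFun := fun G =>
        (End.of (biprod.inl ≫ End.asHom G ≫ biprod.fst), End.of (biprod.inr ≫ End.asHom G ≫ biprod.snd))
      invFun := fun p => End.of (biprod.map (End.asHom p.1) (End.asHom p.2))
      left_inv := fun G => biprod_map_corners_eq hAB hBA (End.asHom G)
      right_inv := fun p => Prod.ext
        (show biprod.inl ≫ biprod.map (End.asHom p.1) (End.asHom p.2) ≫ biprod.fst = End.asHom p.1 by
          rw [biprod.map_fst, biprod.inl_fst_assoc])
        (show biprod.inr ≫ biprod.map (End.asHom p.1) (End.asHom p.2) ≫ biprod.snd = End.asHom p.2 by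
          rw [biprod.map_snd, biprod.inr_snd_assoc])
      map_mul' := fun G H => Prod.ext
        (by
          change biprod.inl ≫ (End.asHom H ≫ End.asHom G) ≫ biprod.fst =
            (biprod.inl ≫ End.asHom H ≫ biprod.fst) ≫ (biprod.inl ≫ End.asHom G ≫ biprod.fst)
          conv_lhs => rw [← Category.id_comp (End.asHom G), ← biprod.total]
          simp only [Preadditive.add_comp, Preadditive.comp_add, Category.assoc]
          rw [hBA (biprod.inr ≫ End.asHom G ≫ biprod.fst), comp_zero, comp_zero, comp_zero, add_zero])
        (by
          change biprod.inr ≫ (End.asHom H ≫ End.asHom G) ≫ biprod.snd =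
            (biprod.inr ≫ End.asHom H ≫ biprod.snd) ≫ (biprod.inr ≫ End.asHom G ≫ biprod.snd)
          conv_lhs => rw [← Category.id_comp (End.asHom G), ← biprod.total]
          simp only [Preadditive.add_comp, Preadditive.comp_add, Category.assoc]
          rw [hAB (biprod.inl ≫ End.asHom G ≫ biprod.snd), comp_zero, comp_zero, comp_zero, zero_add])
      map_add' := fun G H => Prod.ext
        (by
          change biprod.inl ≫ (End.asHom G + End.asHom H) ≫ biprod.fst =
            biprod.inl ≫ End.asHom G ≫ biprod.fst + biprod.inl ≫ End.asHom H ≫ biprod.fst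
          rw [Preadditive.add_comp, Preadditive.comp_add])
        (by
          change biprod.inr ≫ (End.asHom G + End.asHom H) ≫ biprod.snd =
            biprod.inr ≫ End.asHom G ≫ biprod.snd + biprod.inr ≫ End.asHom H ≫ biprod.snd
          rw [Preadditive.add_comp, Preadditive.comp_add]) }
  exact ⟨e, fun G => rfl⟩

/-! ## §2 `End⁰(A ⊞ B) ≅ End⁰(A) × End⁰(B)` and the dimension formula, also for `A.prod B` -/

/-- **`End⁰(A ⊞ B) ≃ₐ[ℚ] End⁰(A) × End⁰(B)` for an orthogonal pair** (`ℚ ⊗_ℤ -` of §1 and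
`ℚ ⊗_ℤ (R × S) ≅ (ℚ ⊗_ℤ R) × (ℚ ⊗_ℤ S)`, Mathlib `Algebra.TensorProduct.prodRight`).
[cite: MumfordAV1970, §19 Cor. 2 of Thm. 3 and p. 174] [cite: Shimura1998, §5.1 (proof of Proposition 3)] -/
theorem nonempty_algEquiv_endAlgebra_biprod_prod (hAB : ∀ f : A ⟶ B, f = 0) (hBA : ∀ g : B ⟶ A, g = 0) :
    Nonempty ((A ⊞ B).endAlgebra ≃ₐ[ℚ] A.endAlgebra × B.endAlgebra) := by
  obtain ⟨e, -⟩ := exists_ringEquiv_end_biprod_prod hAB hBA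
  let eZ : End (A ⊞ B) ≃ₐ[ℤ] End A × End B := AlgEquiv.ofRingEquiv (f := e) fun x => by simp
  let E : (A ⊞ B).endAlgebra ≃ₐ[ℚ] A.endAlgebra × B.endAlgebra :=
    (Algebra.TensorProduct.congr (AlgEquiv.refl : ℚ ≃ₐ[ℚ] ℚ) eZ).trans
      (Algebra.TensorProduct.prodRight ℤ ℚ ℚ (End A) (End B))
  exact ⟨E⟩

/-- **`dim_ℚ End⁰(A ⊞ B) = dim_ℚ End⁰(A) + dim_ℚ End⁰(B)`** when `Hom(A, B) = Hom(B, A) = 0`.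
[cite: MumfordAV1970, §19 Cor. 2 of Thm. 3 and p. 174] -/
theorem finrank_endAlgebra_biprod_of_hom_eq_zero (hAB : ∀ f : A ⟶ B, f = 0) (hBA : ∀ g : B ⟶ A, g = 0) :
    Module.finrank ℚ (A ⊞ B).endAlgebra = Module.finrank ℚ A.endAlgebra + Module.finrank ℚ B.endAlgebra := by
  obtain ⟨e⟩ := nonempty_algEquiv_endAlgebra_biprod_prod hAB hBA
  rw [e.toLinearEquiv.finrank_eq, Module.finrank_prod]

/-- **`dim_ℚ End⁰(A × B) = dim_ℚ End⁰(A) + dim_ℚ End⁰(B)`** for the product abelian variety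
`A.prod B` when `Hom(A, B) = Hom(B, A) = 0` (transport along the isomorphism `A ⊞ B ≅ A × B`,
`biprodIsoProd`, an isogeny). [cite: MumfordAV1970, §19 Cor. 2 of Thm. 3 and p. 174]
[cite: Shimura1998, §5.1 (proof of Proposition 3)] -/
theorem finrank_endAlgebra_prod_of_hom_eq_zero (hAB : ∀ f : A ⟶ B, f = 0) (hBA : ∀ g : B ⟶ A, g = 0) :
    Module.finrank ℚ (A.prod B).endAlgebra = Module.finrank ℚ A.endAlgebra + Module.finrank ℚ B.endAlgebra := by
  rw [← finrank_endAlgebra_biprod_of_hom_eq_zero hAB hBA]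
  exact (IsIsogenous.finrank_endAlgebra_eq ⟨(biprodIsoProd A B).hom, isIsogeny_hom_of_iso _⟩).symm

/-! ## §3 The two standard sources of orthogonality -/

/-- **Simple and non-isogenous factors** (over an algebraically closed field: a non-zero homomorphism
between simple abelian varieties is an isogeny): `dim_ℚ End⁰(A × B) = dim_ℚ End⁰(A) + dim_ℚ End⁰(B)`.
[cite: MumfordAV1970, §19 Cor. 2 of Thm. 1 (p. 174) and Cor. 2 of Thm. 3] -/
theorem finrank_endAlgebra_prod_of_isSimple_of_not_isIsogenous {K : Type u} [Field K] [IsAlgClosed K]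
    {A B : AbelianVariety K} (hA : A.IsSimple) (hB : B.IsSimple) (h : ¬ IsIsogenous A B) :
    Module.finrank ℚ (A.prod B).endAlgebra = Module.finrank ℚ A.endAlgebra + Module.finrank ℚ B.endAlgebra :=
  finrank_endAlgebra_prod_of_hom_eq_zero
    (fun f => by_contra fun hf => h ⟨f, isIsogeny_of_isSimple_of_ne_zero hA hB f hf⟩)
    (fun g => by_contra fun hg => h (IsIsogenous.symm' ⟨g, isIsogeny_of_isSimple_of_ne_zero hB hA g hg⟩))

/-- **Simple factors of different dimensions** (an isogeny preserves the dimension):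
`dim_ℚ End⁰(A × B) = dim_ℚ End⁰(A) + dim_ℚ End⁰(B)` — e.g. `Y₅ × E`, `Y₄ × E`, `Y₃ × E` in Table X.
[cite: MumfordAV1970, §19 Cor. 2 of Thm. 1 (p. 174) and Cor. 2 of Thm. 3] -/
theorem finrank_endAlgebra_prod_of_isSimple_of_dim_ne {K : Type u} [Field K] [IsAlgClosed K]
    {A B : AbelianVariety K} (hA : A.IsSimple) (hB : B.IsSimple) (h : A.dim ≠ B.dim) :
    Module.finrank ℚ (A.prod B).endAlgebra = Module.finrank ℚ A.endAlgebra + Module.finrank ℚ B.endAlgebra :=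
  finrank_endAlgebra_prod_of_isSimple_of_not_isIsogenous hA hB fun ⟨_, hf⟩ => h (dim_eq_of_isIsogeny hf)

/-- **A simple factor not of CM type against a factor of CM type** (over `ℂ`; CM type passes to simple
sub- and quotient abelian varieties, so there is no non-zero homomorphism either way — the tree's
`IsOfCMType.of_ne_zero_hom_from_isSimple` / `…_to_isSimple`): `dim_ℚ End⁰(A × C) = dim_ℚ End⁰(A) + dim_ℚ End⁰(C)`
— e.g. `Y₃ × Z₃` (row 22) and `Y × E_k` with `E_k` CM in Table X. [cite: Milne1999, §2 p. 54]
[cite: MumfordAV1970, §19 Cor. 2 of Thm. 3 and p. 174] -/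
theorem finrank_endAlgebra_prod_of_isSimple_of_not_isOfCMType {A C : AbelianVariety ℂ} (hA : A.IsSimple)
    (hcm : ¬ Milne1999.IsOfCMType A) (hC : Milne1999.IsOfCMType C) :
    Module.finrank ℚ (A.prod C).endAlgebra = Module.finrank ℚ A.endAlgebra + Module.finrank ℚ C.endAlgebra :=
  finrank_endAlgebra_prod_of_hom_eq_zero
    (fun f => by_contra fun hf => hcm (hC.of_ne_zero_hom_from_isSimple hA f hf))
    (fun g => by_contra fun hg => hcm (hC.of_ne_zero_hom_to_isSimple hA g hg))

end AbelianVariety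

end Literature.AlgebraicGeometry.Motives

end
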